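import Summits.CriticalPhenomena.PercolationContinuityZ3.Theorems.PercNearOneGluingNoHeavyLowerTailSunflowerMultiPetalClutterIdentification
import Summits.CriticalPhenomena.PercolationContinuityZ3.Theorems.PercNearOneGluingNoHeavyLowerTailSunflowerMultiPetalBottomSpectatorOrder
import HarnessLib
import HarnessLib.Audit

/-!
# `NoHeavyLowerTail` (crux stmt-CriticalPhenomena-4575), abstract sunflower cubic, `k` petals: THE REDUCTION THEOREM — the window form of the
# vertex-identification conjecture (`ClutterIdentificationQKW`, CN′) implies LEMMA B (`0 ≤ QKW W` on every window) for EVERY family of members of size 1 or 2,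
# i.e. for all multigraphs with marks — hence for all graphs

Support file (seat `prim-l12-p2` gen 38; `--supports stmt-CriticalPhenomena-4575`; companion of `…MultiPetalClutterIdentification` (p392883: `identFamily`, `QKWsep`,
`QKWtog`, `QKW_eq_QKWsep_add_QKWtog`, `identPre`, …) and `…MultiPetalBottomSpectatorOrder` (p379915: the termwise one-point rules `QKW_le_QKW_insert_of_lab_singleton_ne_zero`,
`QKW_insert_eq_three_mul_of_inert`, `QKW_insert_ge_of_pendant`) and `…MultiPetalClutterPendant` (`ofClutter_actsThrough`, `ofClutter_inert`, `ofClutter_lab_pair_ne_zero`)).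
No `sorry`; nothing is asserted about the crux; `ClutterIdentificationQKW` is an `@[conjecture]` obligation, never a fact.
Memo: run/shared/lean/prim/prim-l12/prim-l12-p2/FINDING-g38-VERTEX-IDENTIFICATION.md §2 (THEOREM 1′).

* `QKW_identFamily_window` : for a window `W` with `u ∈ W ↔ v ∈ W`, `QKW (W restricted to {x // x ≠ v}) (ofClutter (G/uv)) = QKWtog W u v` (window form of `QKW_identFamily`).
* `ClutterIdentificationQKW` (CN′, OPEN; census-clean: all 241 183 318 non-adjacent and 242 669 768 adjacent common-neighbour pairs of all graphs on 10 vertices, all pairs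
  on ≤ 9 vertices, random multigraphs): for a family with members of size ≤ 2, a window `W` containing no singleton member, and `u ≠ v ∈ W` with a common neighbour `w ∈ W`
  ({u,w}, {v,w} members; u, v may be adjacent), `0 ≤ QKWsep W u v` — CN for the multigraph induced on `W`.
* `QKW_nonneg_of_clutterIdentificationQKW` (THEOREM 1′): CN′ ⟹ `0 ≤ (ofClutter E).QKW W` for every family `E` of members of size 1 or 2 and every window `W` — by
  strong induction on `|W|` over all such families: a singleton member inside `W` (non-bottom singleton rule), an inert point, a pair with a common neighbour (CN′ +
  `QKW_identFamily_window` + induction for the identified family on `{x // x ≠ v}`), or else every point of `W` is pendant (pendant rule).  Corollaries: Lemma B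
  `0 ≤ QKW univ` and ★ₖ `0 ≤ ZK` for every multigraph with marks (`ZK_nonneg_of_clutterIdentificationQKW`, via `QKW_le_ZKW`).
-/

namespace Summit.CriticalPhenomena.PercolationContinuityZ3.Theorems.SunflowerPartition

open Finset

variable {α : Type*} [DecidableEq α] [Fintype α] {k : ℕ}

/-! ## Window form of `Q(G/uv) = QKWtog` -/

section Window
variable (E : Fin k → Finset α) (u v : α) (huv : u ≠ v)

/-- Preimages of blocks of a restricted window lie in the window. [this work] -/
theorem identPre_subset_of_subset {W : Finset α} (hW : u ∈ W ↔ v ∈ W) {X' : Finset {x : α // x ≠ v}} (hX' : X' ⊆ W.subtype fun x => x ≠ v) :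
    identPre u v huv X' ⊆ W := by
  intro x hx
  have hx' := (mem_identPre u v huv).1 hx
  have hmem := Finset.mem_subtype.1 (hX' hx')
  by_cases hxv : x = v
  · subst hxv
    rw [identMap_v] at hmem
    exact hW.1 hmem
  · rw [identMap_of_ne u v huv hxv] at hmem
    exact hmem

/-- **Window form of `QKW_identFamily`**: for a window `W` not separating `u` from `v`, the bottom-spectator functional of the identified family on the restricted
window equals the non-separated part of `QKW W`. [this work] -/
theorem QKW_identFamily_window (hne : ∀ i, (E i).Nonempty) (W : Finset α) (hW : u ∈ W ↔ v ∈ W) :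
    (MSunflower.ofClutter (identFamily u v huv E)).QKW (W.subtype fun x => x ≠ v) = (MSunflower.ofClutter E).QKWtog W u v := by
  have hne' : ∀ i, (identFamily u v huv E i).Nonempty := fun i => (hne i).image _
  set W' := W.subtype fun x => x ≠ v with hW'def
  have hpreW : identPre u v huv W' = W := identPre_subtype u v huv W hW
  have hR : (MSunflower.ofClutter E).QKWtog W u v =
      ∑ X ∈ W.powerset.filter (fun X => (u ∈ X ↔ v ∈ X)),
        ∑ Y ∈ (W \ X).powerset.filter (fun Y => (u ∈ Y ↔ v ∈ Y)),
          qK k ((MSunflower.ofClutter E).lab X) ((MSunflower.ofClutter E).lab Y) ((MSunflower.ofClutter E).lab ((W \ X) \ Y)) := by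
    unfold MSunflower.QKWtog nested
    rw [Finset.sum_filter]
    refine sum_congr rfl fun X _ => ?_
    rw [Finset.sum_filter]
    by_cases hX : (u ∈ X ↔ v ∈ X)
    · rw [if_pos hX]
      refine sum_congr rfl fun Y _ => ?_
      dsimp only
      by_cases hY : (u ∈ Y ↔ v ∈ Y)
      · rw [if_pos (And.intro hX hY), if_pos hY]
      · rw [if_neg (fun h : (u ∈ X ↔ v ∈ X) ∧ (u ∈ Y ↔ v ∈ Y) => hY h.2), if_neg hY]
    · rw [if_neg hX]
      refine sum_eq_zero fun Y _ => ?_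
      dsimp only
      rw [if_neg (fun h : (u ∈ X ↔ v ∈ X) ∧ (u ∈ Y ↔ v ∈ Y) => hX h.1)]
  rw [hR]
  unfold MSunflower.QKW nested
  refine Finset.sum_nbij' (fun X' => identPre u v huv X') (fun X => X.subtype fun x => x ≠ v) ?_ ?_ ?_ ?_ ?_
  · intro X' hX'
    exact mem_filter.2 ⟨mem_powerset.2 (identPre_subset_of_subset u v huv hW (mem_powerset.1 hX')), u_mem_identPre_iff u v huv X'⟩
  · intro X hX
    have hXW : X ⊆ W := mem_powerset.1 (mem_filter.1 hX).1
    refine mem_powerset.2 fun y hy => ?_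
    rw [Finset.mem_subtype] at hy ⊢
    exact hXW hy
  · intro X' _; exact subtype_identPre u v huv X'
  · intro X hX; exact identPre_subtype u v huv X (mem_filter.1 hX).2
  · intro X' hX'
    have hX'W : X' ⊆ W' := mem_powerset.1 hX'
    refine Finset.sum_nbij' (fun Y' => identPre u v huv Y') (fun Y => Y.subtype fun x => x ≠ v) ?_ ?_ ?_ ?_ ?_
    · intro Y' hY'
      have hsub : Y' ⊆ W' \ X' := mem_powerset.1 hY'
      refine mem_filter.2 ⟨mem_powerset.2 ?_, u_mem_identPre_iff u v huv Y'⟩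
      intro x hx
      have hx' := (mem_identPre u v huv).1 hx
      have hxWX := mem_sdiff.1 (hsub hx')
      refine mem_sdiff.2 ⟨?_, fun hxX => hxWX.2 ((mem_identPre u v huv).1 hxX)⟩
      exact identPre_subset_of_subset u v huv hW (fun y hy => (mem_sdiff.1 (hsub hy)).1) hx
    · intro Y hY
      have hsub : Y ⊆ W \ identPre u v huv X' := mem_powerset.1 (mem_filter.1 hY).1
      refine mem_powerset.2 fun y hy => ?_
      rw [Finset.mem_subtype] at hy
      have hyW := mem_sdiff.1 (hsub hy)
      refine mem_sdiff.2 ⟨Finset.mem_subtype.2 hyW.1, fun hyX => ?_⟩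
      exact hyW.2 ((mem_identPre u v huv).2 (by rw [identMap_of_ne u v huv y.2]; exact hyX))
    · intro Y' _; exact subtype_identPre u v huv Y'
    · intro Y hY; exact identPre_subtype u v huv Y (mem_filter.1 hY).2
    · intro Y' hY'
      have hsub : Y' ⊆ W' \ X' := mem_powerset.1 hY'
      have hd12 : Disjoint X' Y' := by
        rw [Finset.disjoint_left]; intro x hx hy; exact (mem_sdiff.1 (hsub hy)).2 hx
      have hd13 : Disjoint X' ((W' \ X') \ Y') := (Finset.disjoint_sdiff).mono_right sdiff_subset
      have hd23 : Disjoint Y' ((W' \ X') \ Y') := Finset.disjoint_sdiff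
      have he12 : Disjoint (identPre u v huv X') (identPre u v huv Y') := disjoint_identPre u v huv hd12
      have he13 : Disjoint (identPre u v huv X') ((W \ identPre u v huv X') \ identPre u v huv Y') :=
        (Finset.disjoint_sdiff).mono_right sdiff_subset
      have he23 : Disjoint (identPre u v huv Y') ((W \ identPre u v huv X') \ identPre u v huv Y') := Finset.disjoint_sdiff
      dsimp only
      rw [qK_lab_eq_lbW _ hne' hd12 hd13 hd23, qK_lab_eq_lbW E hne he12 he13 he23,
        capOf_identFamily, capOf_identFamily, capOf_identFamily, identPre_sdiff, identPre_sdiff, hpreW]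

end Window

/-! ## The window form of CN and the reduction theorem -/

/-- **VERTEX-IDENTIFICATION CONJECTURE, window form (CN′)** (this work; OPEN; evidence in the file header and memo §1): for a family of members of size ≤ 2, a window `W`
containing no singleton member, and `u ≠ v` in `W` with a common neighbour `w ∈ W` (`{u,w}` and `{v,w}` are members, necessarily inside `W`; `u, v` may be adjacent),
the separated part of `QKW W` is nonnegative (this is CN for the multigraph induced on `W`).  An obligation, never a fact: use as `(h : ClutterIdentificationQKW)`. [status: open] -/
@[conjecture] def ClutterIdentificationQKW : Prop :=
  ∀ (k : ℕ) (α : Type) [Fintype α] [DecidableEq α] (E : Fin k → Finset α) (W : Finset α) (u v w : α),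
    (∀ i, (E i).card ≤ 2) → (∀ i, E i ⊆ W → (E i).card = 2) → u ≠ v → u ∈ W → v ∈ W → w ∈ W →
      (∃ i, E i = {u, w}) → (∃ j, E j = {v, w}) → 0 ≤ (MSunflower.ofClutter E).QKWsep W u v

/-- **THEOREM 1′ (reduction).**  CN′ ⟹ `0 ≤ QKW W` for every window of every family of members of size 1 or 2 (all multigraphs with marks). [this work] -/
theorem QKW_nonneg_of_clutterIdentificationQKW (h : ClutterIdentificationQKW) :
    ∀ (n : ℕ) {β : Type} [Fintype β] [DecidableEq β] {k : ℕ} (E : Fin k → Finset β),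
      (∀ i, 1 ≤ (E i).card ∧ (E i).card ≤ 2) → ∀ W : Finset β, W.card = n → 0 ≤ (MSunflower.ofClutter E).QKW W := by
  intro n
  induction n using Nat.strong_induction_on with
  | _ n ih =>
  intro β _ _ k E hE W hWn
  have hne : ∀ i, (E i).Nonempty := fun i => card_pos.1 (hE i).1
  -- (A) a singleton member inside W
  by_cases hA : ∃ x ∈ W, ∃ i, E i = {x}
  · obtain ⟨x, hxW, i, hi⟩ := hA
    have hlab : (MSunflower.ofClutter E).lab {x} ≠ 0 := by
      rw [Ne, ofClutter_lab_eq_zero_iff, memCount_eq_zero_iff]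
      push Not
      exact ⟨i, by rw [hi]⟩
    have hx : x ∉ W.erase x := notMem_erase x W
    have hstep := (MSunflower.ofClutter E).QKW_le_QKW_insert_of_lab_singleton_ne_zero (W.erase x) x hx hlab
    rw [insert_erase hxW] at hstep
    have hpos : 0 < W.card := card_pos.2 ⟨x, hxW⟩
    have hcard : (W.erase x).card < n := by rw [card_erase_of_mem hxW]; omega
    exact le_trans (ih _ hcard E hE (W.erase x) rfl) hstep
  push Not at hA
  -- from here on every member inside W has two elements
  have hW2 : ∀ i, E i ⊆ W → (E i).card = 2 := by
    intro i hi
    rcases Nat.lt_or_ge ((E i).card) 2 with hlt | hge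
    · exfalso
      have h1 : (E i).card = 1 := by have := (hE i).1; omega
      obtain ⟨x, hx⟩ := card_eq_one.1 h1
      exact hA x (by have := hi (show x ∈ E i by rw [hx]; exact mem_singleton_self x); exact this) i hx
    · have := (hE i).2; omega
  -- (B) an inert point of W
  by_cases hB : ∃ x ∈ W, ∀ i, x ∈ E i → ¬ E i ⊆ W
  · obtain ⟨x, hxW, hx⟩ := hB
    have hx' : x ∉ W.erase x := notMem_erase x W
    have hinert := MSunflower.ofClutter_inert E (W.erase x) x (by intro i hi; rw [insert_erase hxW]; exact hx i hi)
    have hstep := (MSunflower.ofClutter E).QKW_insert_eq_three_mul_of_inert (W.erase x) x hx' hinert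
    rw [insert_erase hxW] at hstep
    have hpos : 0 < W.card := card_pos.2 ⟨x, hxW⟩
    have hcard : (W.erase x).card < n := by rw [card_erase_of_mem hxW]; omega
    have := ih _ hcard E hE (W.erase x) rfl
    rw [hstep]; linarith
  push Not at hB
  -- (C) two points of W with a common neighbour (members {u,w}, {v,w} inside W)
  by_cases hC : ∃ u ∈ W, ∃ v ∈ W, ∃ w ∈ W, u ≠ v ∧ (∃ i, E i = {u, w}) ∧ ∃ j, E j = {v, w}
  · obtain ⟨u, huW, v, hvW, w, hwW, huv, ⟨i, hi⟩, ⟨j, hj⟩⟩ := hC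
    have hsep : 0 ≤ (MSunflower.ofClutter E).QKWsep W u v :=
      h k β E W u v w (fun i => (hE i).2) hW2 huv huW hvW hwW ⟨i, hi⟩ ⟨j, hj⟩
    rw [(MSunflower.ofClutter E).QKW_eq_QKWsep_add_QKWtog W u v,
      ← QKW_identFamily_window E u v huv hne W ⟨fun _ => hvW, fun _ => huW⟩]
    have hE' : ∀ i, 1 ≤ (identFamily u v huv E i).card ∧ (identFamily u v huv E i).card ≤ 2 := by
      intro i
      constructor
      · exact card_pos.2 ((hne i).image _)
      · exact le_trans card_image_le (hE i).2
    have hcard : (W.subtype fun x => x ≠ v).card < n := by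
      have h1 : (W.subtype fun x => x ≠ v).card = (W.filter fun x => x ≠ v).card := Finset.card_subtype _ _
      have h2 : (W.filter fun x => x ≠ v).card < W.card := by
        apply card_lt_card
        refine ⟨filter_subset _ _, fun hsub => ?_⟩
        have := (mem_filter.1 (hsub hvW)).2
        exact this rfl
      omega
    have := ih _ hcard (identFamily u v huv E) hE' (W.subtype fun x => x ≠ v) rfl
    linarith
  push Not at hC
  -- (D) W is empty or every point of W is pendant
  rcases W.eq_empty_or_nonempty with hW0 | ⟨x, hxW⟩
  · subst hW0; rw [(MSunflower.ofClutter E).QKW_empty]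
  -- x lies on some member inside W (not inert), of size 2: {x, y}
  obtain ⟨i, hxi, hiW⟩ := hB x hxW
  have hci := hW2 i hiW
  obtain ⟨y, hyi, hyx⟩ : ∃ y ∈ E i, y ≠ x := by
    by_contra hcon
    push Not at hcon
    have : E i ⊆ {x} := fun z hz => mem_singleton.2 (hcon z hz)
    have := card_le_card this
    rw [card_singleton] at this
    omega
  have hsub : ({x, y} : Finset β) ⊆ E i := by
    intro z hz
    rw [mem_insert, mem_singleton] at hz
    rcases hz with rfl | rfl
    · exact hxi
    · exact hyi
  have hExy : E i = {x, y} := (eq_of_subset_of_card_le hsub (by rw [card_pair hyx.symm]; omega)).symm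
  have hyW : y ∈ W := hiW hyi
  -- every member through x inside W equals {x, y}: otherwise two members {x,y}, {x,z} give y, z a common neighbour x (case C)
  have hthrough : ∀ j, x ∈ E j → E j ⊆ insert x (W.erase x) → y ∈ E j := by
    intro j hxj hjW
    rw [insert_erase hxW] at hjW
    have hcj := hW2 j hjW
    obtain ⟨z, hzj, hzx⟩ : ∃ z ∈ E j, z ≠ x := by
      by_contra hcon
      push Not at hcon
      have : E j ⊆ {x} := fun t ht => mem_singleton.2 (hcon t ht)
      have := card_le_card this
      rw [card_singleton] at this
      omega
    have hsubz : ({x, z} : Finset β) ⊆ E j := by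
      intro t ht
      rw [mem_insert, mem_singleton] at ht
      rcases ht with rfl | rfl
      · exact hxj
      · exact hzj
    have hExz : E j = {x, z} := (eq_of_subset_of_card_le hsubz (by rw [card_pair hzx.symm]; omega)).symm
    by_cases hyz : y = z
    · rw [hyz]; exact hzj
    · exfalso
      have hzW : z ∈ W := hjW hzj
      -- y and z have the common neighbour x
      refine hC y hyW z hzW x hxW hyz ⟨i, ?_⟩ j ?_
      · rw [hExy, pair_comm]
      · rw [hExz, pair_comm]
  have hact := MSunflower.ofClutter_actsThrough E (W.erase x) x y hyx hthrough
  have hpair : (MSunflower.ofClutter E).lab (insert x {y}) ≠ 0 :=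
    MSunflower.ofClutter_lab_pair_ne_zero E x y i (by rw [hExy])
  have hx' : x ∉ W.erase x := notMem_erase x W
  have hyW' : y ∈ W.erase x := mem_erase.2 ⟨hyx, hyW⟩
  have hstep := (MSunflower.ofClutter E).QKW_insert_ge_of_pendant (W.erase x) x y hx' hyW' hact hpair
  rw [insert_erase hxW] at hstep
  have hpos : 0 < W.card := card_pos.2 ⟨x, hxW⟩
  have hc1 : (W.erase x).card < n := by rw [card_erase_of_mem hxW]; omega
  have hc2 : ((W.erase x).erase y).card < n := by rw [card_erase_of_mem hyW', card_erase_of_mem hxW]; omega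
  have h1 := ih _ hc1 E hE (W.erase x) rfl
  have h2 := ih _ hc2 E hE ((W.erase x).erase y) rfl
  linarith

/-- **CN′ ⟹ LEMMA B for every multigraph with marks** (`0 ≤ QKW univ`), in particular for every graph. [this work] -/
theorem QKW_univ_nonneg_of_clutterIdentificationQKW (h : ClutterIdentificationQKW) {β : Type} [Fintype β] [DecidableEq β] {k : ℕ}
    (E : Fin k → Finset β) (hE : ∀ i, 1 ≤ (E i).card ∧ (E i).card ≤ 2) : 0 ≤ (MSunflower.ofClutter E).QKW univ :=
  QKW_nonneg_of_clutterIdentificationQKW h _ E hE univ rfl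

/-- **CN′ ⟹ ★ₖ for every multigraph with marks** (`0 ≤ ZK`). [this work] -/
theorem ZK_nonneg_of_clutterIdentificationQKW (h : ClutterIdentificationQKW) {β : Type} [Fintype β] [DecidableEq β] {k : ℕ}
    (E : Fin k → Finset β) (hE : ∀ i, 1 ≤ (E i).card ∧ (E i).card ≤ 2) : 0 ≤ (MSunflower.ofClutter E).ZK := by
  rw [← (MSunflower.ofClutter E).ZKW_univ]
  exact le_trans (QKW_univ_nonneg_of_clutterIdentificationQKW h E hE) ((MSunflower.ofClutter E).QKW_le_ZKW univ)

end Summit.CriticalPhenomena.PercolationContinuityZ3.Theorems.SunflowerPartition
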